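import Mathlib.Data.Fin.Tuple.Basic
import Mathlib.Data.Finset.Image
import Mathlib.Order.Monotone.Basic
import Mathlib.Tactic.Push
import Mathlib.Tactic.SplitIfs
import HarnessLib

/-!
# Monotone read-once Boolean formulas on the cube `Fin n → Bool` — definitions and bookkeeping

Definitions file (cell `prim-bnk`, seat bnk-2 gen 20; `--supports stmt-CriticalPhenomena-4575`; memo
`run/shared/lean/prim/prim-l12/FROM-prim-bnk-2-g20-CP-CERTIFICATES.md`).  The objects needed to state and prove the comb form
of the master-family `F`-inequality for READ-ONCE third events (companion files `…FCombPiStep`, `…FCombPeelable`,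
`…FCombReadOnce`): monotone AND/OR formulas `MForm n` over the variables `Fin n`, their evaluation `eval`, variable set `vars`,
the read-once predicate `ReadOnce` (children of every gate mention disjoint variables), constant-absorbing smart constructors
`mkAnd`/`mkOr`, the substitution-and-reindexing map `substMap e t ψ` (used to pass to the section `x_e := t` one dimension down)
and the normalisation `norm`, with the elementary lemmas (evaluation, variables, read-once and normal-form preservation,
monotonicity of `eval`, independence from absent variables).  No `sorry`, standard axioms; nothing here is specific to
percolation. [this work]
-/

namespace Summit.CriticalPhenomena.PercolationContinuityZ3.Theorems

namespace SahiFComb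

open Finset

/-! ### 1. Monotone Boolean formulas, read-once formulas -/

/-- Monotone (negation-free) Boolean formulas over the variables `Fin n`. -/
inductive MForm (n : ℕ) : Type
  | var (i : Fin n) : MForm n
  | tt : MForm n
  | ff : MForm n
  | and (f g : MForm n) : MForm n
  | or (f g : MForm n) : MForm n
  deriving DecidableEq

namespace MForm

variable {n : ℕ}

/-- Evaluation of a monotone formula at a point of the cube. -/
def eval : MForm n → (Fin n → Bool) → Bool
  | var i, x => x i
  | tt, _ => true
  | ff, _ => false
  | and f g, x => eval f x && eval g x
  | or f g, x => eval f x || eval g x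

/-- The set of variables occurring in a formula. -/
def vars : MForm n → Finset (Fin n)
  | var i => {i}
  | tt => ∅
  | ff => ∅
  | and f g => vars f ∪ vars g
  | or f g => vars f ∪ vars g

/-- Read-once: the two children of every gate mention disjoint sets of variables. -/
def ReadOnce : MForm n → Prop
  | var _ => True
  | tt => True
  | ff => True
  | and f g => Disjoint (vars f) (vars g) ∧ ReadOnce f ∧ ReadOnce g
  | or f g => Disjoint (vars f) (vars g) ∧ ReadOnce f ∧ ReadOnce g

/-- Constant-free formulas (no `tt`/`ff` leaves). -/
def NoConst : MForm n → Prop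
  | var _ => True
  | tt => False
  | ff => False
  | and f g => NoConst f ∧ NoConst g
  | or f g => NoConst f ∧ NoConst g

/-- Normal formulas: a constant, or constant-free. -/
def Normal (φ : MForm n) : Prop := φ = tt ∨ φ = ff ∨ NoConst φ

/-- Smart conjunction absorbing constants. -/
def mkAnd (f g : MForm n) : MForm n :=
  if f = ff ∨ g = ff then ff else if f = tt then g else if g = tt then f else and f g

/-- Smart disjunction absorbing constants. -/
def mkOr (f g : MForm n) : MForm n :=
  if f = tt ∨ g = tt then tt else if f = ff then g else if g = ff then f else or f g

/-- The smart conjunction evaluates as the conjunction. -/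
theorem eval_mkAnd (f g : MForm n) (x : Fin n → Bool) : eval (mkAnd f g) x = (eval f x && eval g x) := by
  unfold mkAnd
  split_ifs with h1 h2 h3
  · rcases h1 with rfl | rfl <;> simp [eval]
  · subst h2; simp [eval]
  · subst h3; simp [eval]
  · rfl

/-- The smart disjunction evaluates as the disjunction. -/
theorem eval_mkOr (f g : MForm n) (x : Fin n → Bool) : eval (mkOr f g) x = (eval f x || eval g x) := by
  unfold mkOr
  split_ifs with h1 h2 h3
  · rcases h1 with rfl | rfl <;> simp [eval]
  · subst h2; simp [eval]
  · subst h3; simp [eval]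
  · rfl

/-- The smart conjunction mentions no new variables. -/
theorem vars_mkAnd (f g : MForm n) : vars (mkAnd f g) ⊆ vars f ∪ vars g := by
  unfold mkAnd
  split_ifs <;> simp [vars]

/-- The smart disjunction mentions no new variables. -/
theorem vars_mkOr (f g : MForm n) : vars (mkOr f g) ⊆ vars f ∪ vars g := by
  unfold mkOr
  split_ifs <;> simp [vars]

/-- The smart conjunction of read-once formulas with disjoint variables is read-once. -/
theorem readOnce_mkAnd {f g : MForm n} (hf : ReadOnce f) (hg : ReadOnce g) (hd : Disjoint (vars f) (vars g)) :
    ReadOnce (mkAnd f g) := by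
  unfold mkAnd
  split_ifs
  · trivial
  · exact hg
  · exact hf
  · exact ⟨hd, hf, hg⟩

/-- The smart disjunction of read-once formulas with disjoint variables is read-once. -/
theorem readOnce_mkOr {f g : MForm n} (hf : ReadOnce f) (hg : ReadOnce g) (hd : Disjoint (vars f) (vars g)) :
    ReadOnce (mkOr f g) := by
  unfold mkOr
  split_ifs
  · trivial
  · exact hg
  · exact hf
  · exact ⟨hd, hf, hg⟩

/-- The smart conjunction of normal formulas is normal. -/
theorem normal_mkAnd {f g : MForm n} (hf : Normal f) (hg : Normal g) : Normal (mkAnd f g) := by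
  unfold mkAnd Normal at *
  split_ifs with h1 h2 h3
  · right; left; rfl
  · exact hg
  · exact hf
  · push Not at h1
    rcases hf with rfl | rfl | hf
    · exact absurd rfl h2
    · exact absurd rfl h1.1
    rcases hg with rfl | rfl | hg
    · exact absurd rfl h3
    · exact absurd rfl h1.2
    exact Or.inr (Or.inr ⟨hf, hg⟩)

/-- The smart disjunction of normal formulas is normal. -/
theorem normal_mkOr {f g : MForm n} (hf : Normal f) (hg : Normal g) : Normal (mkOr f g) := by
  unfold mkOr Normal at *
  split_ifs with h1 h2 h3
  · left; rfl
  · exact hg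
  · exact hf
  · push Not at h1
    rcases hf with rfl | rfl | hf
    · exact absurd rfl h1.1
    · exact absurd rfl h2
    rcases hg with rfl | rfl | hg
    · exact absurd rfl h1.2
    · exact absurd rfl h3
    exact Or.inr (Or.inr ⟨hf, hg⟩)

/-- Substitute the constant `t` for the variable `e` and re-index the other variables through `ψ`, absorbing constants. -/
def substMap {m : ℕ} (e : Fin n) (t : Bool) (ψ : Fin n → Fin m) : MForm n → MForm m
  | var i => if i = e then (if t then tt else ff) else var (ψ i)
  | tt => tt
  | ff => ff
  | and f g => mkAnd (substMap e t ψ f) (substMap e t ψ g)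
  | or f g => mkOr (substMap e t ψ f) (substMap e t ψ g)

/-- Evaluation of `substMap e t ψ φ`: substitute `t` for `x_e` and read the other variables through `ψ`. -/
theorem eval_substMap {m : ℕ} (e : Fin n) (t : Bool) (ψ : Fin n → Fin m) (φ : MForm n) (y : Fin m → Bool) :
    eval (substMap e t ψ φ) y = eval φ (fun j => if j = e then t else y (ψ j)) := by
  induction φ with
  | var i =>
      by_cases h : i = e
      · subst h; cases t <;> simp [substMap, eval]
      · simp [substMap, eval, h]
  | tt => rfl
  | ff => rfl
  | and f g ihf ihg => simp only [substMap, eval_mkAnd, ihf, ihg, eval]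
  | or f g ihf ihg => simp only [substMap, eval_mkOr, ihf, ihg, eval]

/-- The variables of `substMap e t ψ φ` are images under `ψ` of variables of `φ` other than `e`. -/
theorem vars_substMap {m : ℕ} (e : Fin n) (t : Bool) (ψ : Fin n → Fin m) (φ : MForm n) :
    vars (substMap e t ψ φ) ⊆ ((vars φ).erase e).image ψ := by
  induction φ with
  | var i =>
      by_cases h : i = e
      · subst h; cases t <;> simp [substMap, vars]
      · intro j hj
        simp only [substMap, h, if_false, vars, Finset.mem_singleton] at hj
        subst hj
        exact Finset.mem_image.mpr ⟨i, by simp [vars, h], rfl⟩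
  | tt => simp [substMap, vars]
  | ff => simp [substMap, vars]
  | and f g ihf ihg =>
      refine (vars_mkAnd _ _).trans ?_
      refine Finset.union_subset (ihf.trans ?_) (ihg.trans ?_)
      · exact Finset.image_subset_image (Finset.erase_subset_erase _ (by simp [vars]))
      · exact Finset.image_subset_image (Finset.erase_subset_erase _ (by simp [vars]))
  | or f g ihf ihg =>
      refine (vars_mkOr _ _).trans ?_
      refine Finset.union_subset (ihf.trans ?_) (ihg.trans ?_)
      · exact Finset.image_subset_image (Finset.erase_subset_erase _ (by simp [vars]))
      · exact Finset.image_subset_image (Finset.erase_subset_erase _ (by simp [vars]))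

/-- `substMap` produces normal formulas. -/
theorem normal_substMap {m : ℕ} (e : Fin n) (t : Bool) (ψ : Fin n → Fin m) (φ : MForm n) :
    Normal (substMap e t ψ φ) := by
  induction φ with
  | var i =>
      by_cases h : i = e
      · subst h; cases t
        · right; left; simp [substMap]
        · left; simp [substMap]
      · right; right; simp [substMap, h, NoConst]
  | tt => left; rfl
  | ff => right; left; rfl
  | and f g ihf ihg => exact normal_mkAnd ihf ihg
  | or f g ihf ihg => exact normal_mkOr ihf ihg

/-- Read-once is preserved by `substMap` when the re-indexing is injective away from `e`. -/
theorem readOnce_substMap {m : ℕ} (e : Fin n) (t : Bool) (ψ : Fin n → Fin m)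
    (hψ : ∀ i j, i ≠ e → j ≠ e → ψ i = ψ j → i = j) :
    ∀ φ : MForm n, ReadOnce φ → ReadOnce (substMap e t ψ φ) := by
  have key : ∀ f g : MForm n, Disjoint (vars f) (vars g) →
      Disjoint (vars (substMap e t ψ f)) (vars (substMap e t ψ g)) := by
    intro f g hd
    refine Finset.disjoint_left.mpr (fun j hjf hjg => ?_)
    have hf := vars_substMap e t ψ f hjf
    have hg := vars_substMap e t ψ g hjg
    rw [Finset.mem_image] at hf hg
    obtain ⟨i, hi, rfl⟩ := hf
    obtain ⟨i', hi', hii'⟩ := hg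
    rw [Finset.mem_erase] at hi hi'
    have : i' = i := hψ i' i hi'.1 hi.1 hii'
    subst this
    exact Finset.disjoint_left.mp hd hi.2 hi'.2
  intro φ
  induction φ with
  | var i => intro _; by_cases h : i = e <;> [ (subst h; cases t <;> simp [substMap, ReadOnce]) ; simp [substMap, h, ReadOnce] ]
  | tt => intro _; trivial
  | ff => intro _; trivial
  | and f g ihf ihg => intro h; exact readOnce_mkAnd (ihf h.2.1) (ihg h.2.2) (key f g h.1)
  | or f g ihf ihg => intro h; exact readOnce_mkOr (ihf h.2.1) (ihg h.2.2) (key f g h.1)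

/-- Evaluation of a monotone formula is monotone. -/
theorem eval_mono (φ : MForm n) : Monotone (eval φ) := by
  induction φ with
  | var i => exact fun x y h => h i
  | tt => exact fun _ _ _ => le_rfl
  | ff => exact fun _ _ _ => le_rfl
  | and f g ihf ihg =>
      intro x y h
      have hf := ihf h; have hg := ihg h
      simp only [eval]
      revert hf hg
      cases eval f x <;> cases eval f y <;> cases eval g x <;> cases eval g y <;> simp
  | or f g ihf ihg =>
      intro x y h
      have hf := ihf h; have hg := ihg h
      simp only [eval]
      revert hf hg
      cases eval f x <;> cases eval f y <;> cases eval g x <;> cases eval g y <;> simp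

/-- A formula does not depend on variables it does not mention. -/
theorem eval_eq_of_not_mem_vars (φ : MForm n) {e : Fin n} (he : e ∉ vars φ) (x : Fin n → Bool) (t : Bool) :
    eval φ (Function.update x e t) = eval φ x := by
  induction φ with
  | var i =>
      have : i ≠ e := fun h => he (by simp [vars, h])
      simp [eval, Function.update, this]
  | tt => rfl
  | ff => rfl
  | and f g ihf ihg =>
      simp only [vars, Finset.mem_union, not_or] at he
      simp only [eval, ihf he.1, ihg he.2]
  | or f g ihf ihg =>
      simp only [vars, Finset.mem_union, not_or] at he
      simp only [eval, ihf he.1, ihg he.2]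

/-- Normalisation of an arbitrary formula (absorb the constants). -/
def norm : MForm n → MForm n
  | var i => var i
  | tt => tt
  | ff => ff
  | and f g => mkAnd f.norm g.norm
  | or f g => mkOr f.norm g.norm

/-- Normalisation preserves evaluation. -/
theorem eval_norm (φ : MForm n) : φ.norm.eval = φ.eval := by
  funext x
  induction φ with
  | var i => rfl
  | tt => rfl
  | ff => rfl
  | and f g ihf ihg => simp only [norm, eval_mkAnd, ihf, ihg, eval]
  | or f g ihf ihg => simp only [norm, eval_mkOr, ihf, ihg, eval]

/-- Normalisation does not introduce variables. -/
theorem vars_norm (φ : MForm n) : φ.norm.vars ⊆ φ.vars := by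
  induction φ with
  | var i => exact subset_rfl
  | tt => exact subset_rfl
  | ff => exact subset_rfl
  | and f g ihf ihg => exact (vars_mkAnd _ _).trans (Finset.union_subset_union ihf ihg)
  | or f g ihf ihg => exact (vars_mkOr _ _).trans (Finset.union_subset_union ihf ihg)

/-- Normalisation preserves read-once. -/
theorem readOnce_norm (φ : MForm n) (h : φ.ReadOnce) : φ.norm.ReadOnce := by
  induction φ with
  | var i => trivial
  | tt => trivial
  | ff => trivial
  | and f g ihf ihg =>
      exact readOnce_mkAnd (ihf h.2.1) (ihg h.2.2) (h.1.mono (vars_norm f) (vars_norm g))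
  | or f g ihf ihg =>
      exact readOnce_mkOr (ihf h.2.1) (ihg h.2.2) (h.1.mono (vars_norm f) (vars_norm g))

/-- Normalisation produces normal formulas. -/
theorem normal_norm (φ : MForm n) : φ.norm.Normal := by
  induction φ with
  | var i => right; right; trivial
  | tt => left; rfl
  | ff => right; left; rfl
  | and f g ihf ihg => exact normal_mkAnd ihf ihg
  | or f g ihf ihg => exact normal_mkOr ihf ihg


end MForm

end SahiFComb

end Summit.CriticalPhenomena.PercolationContinuityZ3.Theorems
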